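import Summits.NavierStokesRegularity.FunctionalMining.NoGo.LogDoorStrain
import Mathlib.Analysis.SpecificLimits.Basic
import HarnessLib

/-!
# The log-door background: bounded vorticity, arbitrarily large strain (`ℝ³`, explicit)

Search for candidate a priori estimates; no regularity claim. NS FUNCTIONAL MINING — NO-GO BRANCH
(cell `pub-nsfunc`, prove seat gen 3), Euclidean core of the no-go N6. The planar stream function
`ψ_n(x, y) = x y H_n(x² + y²)` with the staircase profile `H_n(q) = Σ_{j<n} β(4^{j+1} q)`
(`β = 1` on `[-2,2]`, `β = 0` off `(-4,4)`, `β(s) = bumpA(s/2)`) has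
* `H_n = n` on the core disc `4ⁿ q < 2` and `H_n = 0` for `q > 1` (`coreH_eq_of_core`,
  `coreH_eq_zero_of_one_lt`);
* `√q H_n(q) ≤ 2`, `|q H_n'(q)| ≤ 4B₁`, `|q² H_n''(q)| ≤ 16B₂` UNIFORMLY IN `n` (`sqrt_mul_coreH_le`,
  `abs_mul_deriv_coreH_le`, `abs_sq_mul_deriv2_coreH_le`): at each `q > 0` at most ONE step of the
  staircase is active (`4^{j+1} q ∈ [2,4]` for at most one `j`), so the vorticity
  `Δψ_n = xy(12H_n' + 4qH_n'')` stays bounded while the strain `∂_x∂_yψ_n(0) = n` is as large as we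
  please — the `L^∞`-unboundedness of vorticity → strain, made explicit and smooth.
The lifted field `background n η = (∂_yψ_n · η(z), −∂_xψ_n · η(z), 0)` (`UG`) is smooth, divergence
free (`background_trace`), equals the linear strain `strain n η` of `NoGo/LogDoorPacket.lean` on the
core (`background_eq_strain`), and vanishes for `x² + y² > 1` (`background_eq_zero_of_one_lt`).
Folklore calculus; nothing is asserted about Navier–Stokes.
-/

open MeasureTheory Set Function Filter
open scoped ContDiff Topology

namespace Summit.NavierStokesRegularity.FunctionalMining

namespace Sep3

/-- `∞ ≠ 0` in `WithTop ℕ∞`. [folklore] -/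
private theorem infty_ne_zero₄ : (∞ : WithTop ℕ∞) ≠ 0 := by simp

/-! ## Locally constant smooth functions have vanishing derivatives -/

/-- If `f = c` on an open set `U` then `f⁽ᵏ⁺¹⁾ = 0` on `U`. [folklore] -/
theorem iteratedDeriv_succ_eq_zero_of_eqOn {f : ℝ → ℝ} {U : Set ℝ} (hU : IsOpen U) {c : ℝ}
    (h : ∀ s ∈ U, f s = c) (k : ℕ) : ∀ s ∈ U, iteratedDeriv (k + 1) f s = 0 := by
  induction k with
  | zero =>
      intro s hs
      rw [zero_add, iteratedDeriv_one]
      have hev : f =ᶠ[𝓝 s] fun _ => c := eventuallyEq_of_mem (hU.mem_nhds hs) fun t ht => h t ht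
      rw [hev.deriv_eq, deriv_const]
  | succ k ih =>
      intro s hs
      rw [iteratedDeriv_succ]
      have hev : iteratedDeriv (k + 1) f =ᶠ[𝓝 s] fun _ => (0 : ℝ) :=
        eventuallyEq_of_mem (hU.mem_nhds hs) fun t ht => ih t ht
      rw [hev.deriv_eq, deriv_const]

/-! ## The step `β` -/

/-- The step `β(s) = bumpA(s/2)`: `= 1` for `|s| ≤ 2`, `= 0` for `|s| ≥ 4`, smooth, `0 ≤ β ≤ 1`.
[folklore] -/
noncomputable def stepB (s : ℝ) : ℝ := bumpA (s / 2)

/-- `β` is smooth. [folklore] -/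
theorem stepB_contDiff : ContDiff ℝ ∞ stepB := bumpA.contDiff.comp (contDiff_id.div_const 2)

/-- `0 ≤ β`. [folklore] -/
theorem stepB_nonneg (s : ℝ) : 0 ≤ stepB s := bumpA.nonneg _

/-- `β ≤ 1`. [folklore] -/
theorem stepB_le_one (s : ℝ) : stepB s ≤ 1 := bumpA.le_one _

/-- `β s = 1` for `|s| ≤ 2`. [folklore] -/
theorem stepB_eq_one {s : ℝ} (hs : |s| ≤ 2) : stepB s = 1 :=
  bumpA.eq_one (by rw [abs_div, abs_two]; linarith)

/-- `β s = 0` for `4 ≤ |s|`. [folklore] -/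
theorem stepB_eq_zero {s : ℝ} (hs : 4 ≤ |s|) : stepB s = 0 :=
  bumpA.eq_zero (by rw [abs_div, abs_two]; linarith)

/-- `β s ≤ 2/√s` for `s > 0` (trivial for `s ≥ 4`, and `2/√s ≥ 1 ≥ β` for `s < 4`). [folklore] -/
theorem stepB_le_two_div_sqrt {s : ℝ} (hs : 0 < s) : stepB s ≤ 2 / Real.sqrt s := by
  by_cases h4 : 4 ≤ s
  · rw [stepB_eq_zero (by rw [abs_of_pos hs]; exact h4)]; positivity
  · push Not at h4
    have hsq : Real.sqrt s < 2 := by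
      rw [show (2 : ℝ) = Real.sqrt 4 by rw [show (4 : ℝ) = 2 ^ 2 by norm_num, Real.sqrt_sq (by norm_num)]]
      exact Real.sqrt_lt_sqrt hs.le h4
    have hsq0 : 0 < Real.sqrt s := Real.sqrt_pos.2 hs
    calc stepB s ≤ 1 := stepB_le_one s
      _ ≤ 2 / Real.sqrt s := by rw [le_div_iff₀ hsq0]; linarith

/-- `β⁽ᵏ⁺¹⁾(s) = 0` for `|s| < 2` (where `β = 1`) and for `4 < |s|` (where `β = 0`). [folklore] -/
theorem iteratedDeriv_stepB_eq_zero (k : ℕ) {s : ℝ} (hs : |s| < 2 ∨ 4 < |s|) :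
    iteratedDeriv (k + 1) stepB s = 0 := by
  rcases hs with hs | hs
  · exact iteratedDeriv_succ_eq_zero_of_eqOn (isOpen_lt continuous_abs continuous_const)
      (c := 1) (fun t ht => stepB_eq_one (le_of_lt ht)) k s hs
  · exact iteratedDeriv_succ_eq_zero_of_eqOn (isOpen_lt continuous_const continuous_abs)
      (c := 0) (fun t ht => stepB_eq_zero (le_of_lt ht)) k s hs

/-- `β⁽ᵏ⁾` is bounded (continuous, supported in `[-4, 4]` for `k ≥ 1`, `≤ 1` for `k = 0`).
[folklore] -/
theorem exists_bound_iteratedDeriv_stepB (k : ℕ) : ∃ B, 0 ≤ B ∧ ∀ s, |iteratedDeriv k stepB s| ≤ B := by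
  have hc : Continuous (iteratedDeriv k stepB) :=
    stepB_contDiff.continuous_iteratedDeriv k (by exact_mod_cast le_top)
  have hs : HasCompactSupport (iteratedDeriv k stepB) := by
    refine HasCompactSupport.intro (isCompact_Icc (a := (-4 : ℝ)) (b := 4)) fun s hs => ?_
    have hs' : 4 < |s| := by
      rw [mem_Icc, not_and_or, not_le, not_le] at hs
      rcases hs with h | h
      · rw [lt_abs]; right; linarith
      · exact lt_of_lt_of_le h (le_abs_self s)
    cases k with
    | zero => rw [iteratedDeriv_zero]; exact stepB_eq_zero hs'.le
    | succ k => exact iteratedDeriv_stepB_eq_zero k (Or.inr hs')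
  obtain ⟨C, hC⟩ := hc.bounded_above_of_compact_support hs
  exact ⟨max C 0, le_max_right _ _, fun s => (Real.norm_eq_abs _ ▸ hC s).trans (le_max_left _ _)⟩

/-! ## The staircase `H_n` -/

/-- The staircase profile `H_n(q) = Σ_{j<n} β(4^{j+1} q)`. [folklore] -/
noncomputable def coreH (n : ℕ) (q : ℝ) : ℝ := ∑ j ∈ Finset.range n, stepB (4 ^ (j + 1) * q)

/-- `H_n` is smooth. [folklore] -/
theorem coreH_contDiff (n : ℕ) : ContDiff ℝ ∞ (coreH n) := by
  unfold coreH
  exact ContDiff.sum fun _ _ => stepB_contDiff.comp (contDiff_const.mul contDiff_id)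

/-- `0 ≤ H_n`. [folklore] -/
theorem coreH_nonneg (n : ℕ) (q : ℝ) : 0 ≤ coreH n q :=
  Finset.sum_nonneg fun _ _ => stepB_nonneg _

/-- On the core `0 ≤ q`, `4ⁿ q ≤ 2`: `H_n(q) = n`. [folklore] -/
theorem coreH_eq_of_core (n : ℕ) {q : ℝ} (hq : 0 ≤ q) (hc : 4 ^ n * q ≤ 2) : coreH n q = n := by
  unfold coreH
  have h : ∀ j ∈ Finset.range n, stepB (4 ^ (j + 1) * q) = 1 := by
    intro j hj
    apply stepB_eq_one
    rw [abs_of_nonneg (by positivity)]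
    have hj' : j + 1 ≤ n := Finset.mem_range.1 hj
    calc (4 : ℝ) ^ (j + 1) * q ≤ 4 ^ n * q :=
          mul_le_mul_of_nonneg_right (pow_le_pow_right₀ (by norm_num) hj') hq
      _ ≤ 2 := hc
  rw [Finset.sum_congr rfl h]
  simp

/-- Off the unit disc (`1 ≤ q`): `H_n(q) = 0`. [folklore] -/
theorem coreH_eq_zero_of_one_le (n : ℕ) {q : ℝ} (hq : 1 ≤ q) : coreH n q = 0 := by
  unfold coreH
  refine Finset.sum_eq_zero fun j _ => stepB_eq_zero ?_
  rw [abs_of_nonneg (by positivity)]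
  have : (4 : ℝ) ≤ 4 ^ (j + 1) := by
    calc (4 : ℝ) = 4 ^ 1 := by norm_num
      _ ≤ 4 ^ (j + 1) := pow_le_pow_right₀ (by norm_num) (by omega)
  nlinarith

/-- **`√q · H_n(q) ≤ 2` for `q ≥ 0`, uniformly in `n`** (geometric series). [folklore] -/
theorem sqrt_mul_coreH_le (n : ℕ) {q : ℝ} (hq : 0 ≤ q) : Real.sqrt q * coreH n q ≤ 2 := by
  rcases hq.eq_or_lt with rfl | hq'
  · simp
  have hsq : 0 < Real.sqrt q := Real.sqrt_pos.2 hq'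
  have hterm : ∀ j ∈ Finset.range n,
      Real.sqrt q * stepB (4 ^ (j + 1) * q) ≤ (1 / 2 : ℝ) ^ j := by
    intro j _
    have h4 : (0 : ℝ) < 4 ^ (j + 1) * q := by positivity
    have hs : Real.sqrt (4 ^ (j + 1) * q) = 2 ^ (j + 1) * Real.sqrt q := by
      rw [Real.sqrt_mul (by positivity), show (4 : ℝ) ^ (j + 1) = (2 ^ (j + 1)) ^ 2 by
        rw [← pow_mul, mul_comm, pow_mul]; norm_num, Real.sqrt_sq (by positivity)]
    calc Real.sqrt q * stepB (4 ^ (j + 1) * q) ≤ Real.sqrt q * (2 / Real.sqrt (4 ^ (j + 1) * q)) :=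
          mul_le_mul_of_nonneg_left (stepB_le_two_div_sqrt h4) hsq.le
      _ = (1 / 2 : ℝ) ^ j := by
          rw [hs, one_div_pow]
          field_simp
          ring
  calc Real.sqrt q * coreH n q = ∑ j ∈ Finset.range n, Real.sqrt q * stepB (4 ^ (j + 1) * q) := by
        rw [coreH, Finset.mul_sum]
    _ ≤ ∑ j ∈ Finset.range n, (1 / 2 : ℝ) ^ j := Finset.sum_le_sum hterm
    _ ≤ 2 := sum_geometric_two_le n

/-- At most one step is active: if `4^{j+1} q, 4^{j'+1} q ∈ [2, 4]` with `q ≥ 0` then `j = j'`.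
[folklore] -/
theorem step_active_unique {q : ℝ} (hq : 0 ≤ q) {j j' : ℕ}
    (hj : 2 ≤ (4 : ℝ) ^ (j + 1) * q ∧ (4 : ℝ) ^ (j + 1) * q ≤ 4)
    (hj' : 2 ≤ (4 : ℝ) ^ (j' + 1) * q ∧ (4 : ℝ) ^ (j' + 1) * q ≤ 4) : j = j' := by
  by_contra hne
  rcases Nat.lt_or_gt_of_ne hne with h | h
  · have : (4 : ℝ) ^ (j + 1) * 4 ≤ 4 ^ (j' + 1) := by
      rw [← pow_succ]; exact pow_le_pow_right₀ (by norm_num) (by omega)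
    nlinarith [hj.1, hj'.2]
  · have : (4 : ℝ) ^ (j' + 1) * 4 ≤ 4 ^ (j + 1) := by
      rw [← pow_succ]; exact pow_le_pow_right₀ (by norm_num) (by omega)
    nlinarith [hj'.1, hj.2]

/-- A finite sum with at most one non-zero term, each bounded by `B ≥ 0`, is bounded by `B`.
[folklore] -/
theorem abs_sum_le_of_atMostOne {ι : Type*} (s : Finset ι) (f : ι → ℝ) {B : ℝ} (hB : 0 ≤ B)
    (hb : ∀ i ∈ s, |f i| ≤ B) (h1 : ∀ i ∈ s, ∀ i' ∈ s, f i ≠ 0 → f i' ≠ 0 → i = i') :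
    |∑ i ∈ s, f i| ≤ B := by
  by_cases hex : ∃ i ∈ s, f i ≠ 0
  · obtain ⟨i₀, hi₀, hf⟩ := hex
    rw [Finset.sum_eq_single_of_mem i₀ hi₀ fun i hi hne => ?_]
    · exact hb i₀ hi₀
    · by_contra h
      exact hne (h1 i hi i₀ hi₀ h hf)
  · push Not at hex
    rw [Finset.sum_eq_zero hex, abs_zero]
    exact hB

/-- The derivative of `H_n`: `H_n'(q) = Σ 4^{j+1} β'(4^{j+1} q)`. [folklore] -/
theorem hasDerivAt_coreH (n : ℕ) (q : ℝ) :
    HasDerivAt (coreH n) (∑ j ∈ Finset.range n, 4 ^ (j + 1) * iteratedDeriv 1 stepB (4 ^ (j + 1) * q)) q := by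
  have hterm : ∀ j ∈ Finset.range n, HasDerivAt (fun q : ℝ => stepB (4 ^ (j + 1) * q))
      (4 ^ (j + 1) * iteratedDeriv 1 stepB (4 ^ (j + 1) * q)) q := by
    intro j _
    have hβ : HasDerivAt stepB (iteratedDeriv 1 stepB (4 ^ (j + 1) * q)) (4 ^ (j + 1) * q) := by
      rw [iteratedDeriv_one]
      exact (stepB_contDiff.differentiable infty_ne_zero₄ _).hasDerivAt
    have hl : HasDerivAt (fun q : ℝ => (4 : ℝ) ^ (j + 1) * q) (4 ^ (j + 1)) q := by
      simpa using (hasDerivAt_id q).const_mul ((4 : ℝ) ^ (j + 1))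
    have h := hβ.comp q hl
    refine h.congr_deriv ?_
    ring
  have e : coreH n = ∑ j ∈ Finset.range n, fun q : ℝ => stepB (4 ^ (j + 1) * q) := by
    funext q; simp [coreH, Finset.sum_apply]
  rw [e]
  exact HasDerivAt.sum hterm

/-- `H_n' = Σ 4^{j+1} β'(4^{j+1}·)` as a function. [folklore] -/
theorem deriv_coreH (n : ℕ) :
    deriv (coreH n) = fun q => ∑ j ∈ Finset.range n, 4 ^ (j + 1) * iteratedDeriv 1 stepB (4 ^ (j + 1) * q) :=
  funext fun q => (hasDerivAt_coreH n q).deriv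

/-- The second derivative of `H_n`: `H_n''(q) = Σ (4^{j+1})² β''(4^{j+1} q)`. [folklore] -/
theorem hasDerivAt_deriv_coreH (n : ℕ) (q : ℝ) :
    HasDerivAt (deriv (coreH n))
      (∑ j ∈ Finset.range n, (4 ^ (j + 1)) ^ 2 * iteratedDeriv 2 stepB (4 ^ (j + 1) * q)) q := by
  rw [deriv_coreH]
  have hterm : ∀ j ∈ Finset.range n,
      HasDerivAt (fun q : ℝ => (4 : ℝ) ^ (j + 1) * iteratedDeriv 1 stepB (4 ^ (j + 1) * q))
        ((4 ^ (j + 1)) ^ 2 * iteratedDeriv 2 stepB (4 ^ (j + 1) * q)) q := by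
    intro j _
    have hβ : HasDerivAt (iteratedDeriv 1 stepB) (iteratedDeriv 2 stepB (4 ^ (j + 1) * q))
        (4 ^ (j + 1) * q) := hasDerivAt_iteratedDeriv stepB_contDiff 1 _
    have hl : HasDerivAt (fun q : ℝ => (4 : ℝ) ^ (j + 1) * q) (4 ^ (j + 1)) q := by
      simpa using (hasDerivAt_id q).const_mul ((4 : ℝ) ^ (j + 1))
    have h := (hβ.comp q hl).const_mul ((4 : ℝ) ^ (j + 1))
    refine h.congr_deriv ?_
    ring
  have e : (fun q : ℝ => ∑ j ∈ Finset.range n, (4 : ℝ) ^ (j + 1) * iteratedDeriv 1 stepB (4 ^ (j + 1) * q)) =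
      ∑ j ∈ Finset.range n, fun q : ℝ => (4 : ℝ) ^ (j + 1) * iteratedDeriv 1 stepB (4 ^ (j + 1) * q) := by
    funext q; simp [Finset.sum_apply]
  rw [e]
  exact HasDerivAt.sum hterm

/-- `H_n'' ` as a function. [folklore] -/
theorem deriv2_coreH (n : ℕ) :
    deriv (deriv (coreH n)) =
      fun q => ∑ j ∈ Finset.range n, (4 ^ (j + 1)) ^ 2 * iteratedDeriv 2 stepB (4 ^ (j + 1) * q) :=
  funext fun q => (hasDerivAt_deriv_coreH n q).deriv

/-- `deriv (coreH n)` and `deriv (deriv (coreH n))` are smooth. [folklore] -/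
theorem contDiff_deriv_coreH (n : ℕ) : ContDiff ℝ ∞ (deriv (coreH n)) ∧
    ContDiff ℝ ∞ (deriv (deriv (coreH n))) := by
  have h1 : ContDiff ℝ ∞ (deriv (coreH n)) := by
    have := (coreH_contDiff n).iterate_deriv 1
    simpa using this
  refine ⟨h1, ?_⟩
  have := (coreH_contDiff n).iterate_deriv 2
  simpa [Function.iterate_succ, Function.comp] using this

/-- A term `β⁽ᵏ⁺¹⁾(4^{j+1}q)` is non-zero only when `2 ≤ 4^{j+1} q ≤ 4` (for `q ≥ 0`). [folklore] -/
theorem step_active_of_ne_zero {q : ℝ} (hq : 0 ≤ q) (k j : ℕ)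
    (h : iteratedDeriv (k + 1) stepB (4 ^ (j + 1) * q) ≠ 0) :
    2 ≤ (4 : ℝ) ^ (j + 1) * q ∧ (4 : ℝ) ^ (j + 1) * q ≤ 4 := by
  by_contra hc
  rw [not_and_or, not_le, not_le] at hc
  apply h
  apply iteratedDeriv_stepB_eq_zero
  rw [abs_of_nonneg (by positivity)]
  exact hc

/-- **`|q · H_n'(q)| ≤ 4B₁` for `q ≥ 0`, uniformly in `n`**, where `B₁` bounds `|β'|`. [folklore] -/
theorem abs_mul_deriv_coreH_le (n : ℕ) {B₁ : ℝ} (hB₁ : 0 ≤ B₁) (hb : ∀ s, |iteratedDeriv 1 stepB s| ≤ B₁)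
    {q : ℝ} (hq : 0 ≤ q) : |q * deriv (coreH n) q| ≤ 4 * B₁ := by
  rw [deriv_coreH, Finset.mul_sum]
  have e : ∀ j ∈ Finset.range n, q * (4 ^ (j + 1) * iteratedDeriv 1 stepB (4 ^ (j + 1) * q)) =
      (4 ^ (j + 1) * q) * iteratedDeriv 1 stepB (4 ^ (j + 1) * q) := fun j _ => by ring
  rw [Finset.sum_congr rfl e]
  refine abs_sum_le_of_atMostOne _ _ (by positivity) (fun j _ => ?_) (fun j _ j' _ hj hj' => ?_)
  · by_cases hz : iteratedDeriv 1 stepB (4 ^ (j + 1) * q) = 0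
    · rw [hz, mul_zero, abs_zero]; positivity
    · have ha := step_active_of_ne_zero hq 0 j hz
      rw [abs_mul, abs_of_nonneg (by positivity)]
      calc 4 ^ (j + 1) * q * |iteratedDeriv 1 stepB (4 ^ (j + 1) * q)| ≤ 4 * B₁ :=
          mul_le_mul ha.2 (hb _) (abs_nonneg _) (by norm_num)
        _ = 4 * B₁ := rfl
  · have hz : iteratedDeriv 1 stepB (4 ^ (j + 1) * q) ≠ 0 := fun h => hj (by rw [h, mul_zero])
    have hz' : iteratedDeriv 1 stepB (4 ^ (j' + 1) * q) ≠ 0 := fun h => hj' (by rw [h, mul_zero])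
    exact step_active_unique hq (step_active_of_ne_zero hq 0 j hz) (step_active_of_ne_zero hq 0 j' hz')

/-- **`|q² · H_n''(q)| ≤ 16B₂` for `q ≥ 0`, uniformly in `n`**, where `B₂` bounds `|β''|`. [folklore] -/
theorem abs_sq_mul_deriv2_coreH_le (n : ℕ) {B₂ : ℝ} (hB₂ : 0 ≤ B₂)
    (hb : ∀ s, |iteratedDeriv 2 stepB s| ≤ B₂) {q : ℝ} (hq : 0 ≤ q) :
    |q ^ 2 * deriv (deriv (coreH n)) q| ≤ 16 * B₂ := by
  rw [deriv2_coreH, Finset.mul_sum]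
  have e : ∀ j ∈ Finset.range n, q ^ 2 * ((4 ^ (j + 1)) ^ 2 * iteratedDeriv 2 stepB (4 ^ (j + 1) * q)) =
      (4 ^ (j + 1) * q) ^ 2 * iteratedDeriv 2 stepB (4 ^ (j + 1) * q) := fun j _ => by ring
  rw [Finset.sum_congr rfl e]
  refine abs_sum_le_of_atMostOne _ _ (by positivity) (fun j _ => ?_) (fun j _ j' _ hj hj' => ?_)
  · by_cases hz : iteratedDeriv 2 stepB (4 ^ (j + 1) * q) = 0
    · rw [hz, mul_zero, abs_zero]; positivity
    · have ha := step_active_of_ne_zero hq 1 j hz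
      rw [abs_mul, abs_of_nonneg (by positivity)]
      have h16 : (4 ^ (j + 1) * q) ^ 2 ≤ 16 := by nlinarith [ha.1, ha.2]
      exact mul_le_mul h16 (hb _) (abs_nonneg _) (by norm_num)
  · have hz : iteratedDeriv 2 stepB (4 ^ (j + 1) * q) ≠ 0 := fun h => hj (by rw [h, mul_zero])
    have hz' : iteratedDeriv 2 stepB (4 ^ (j' + 1) * q) ≠ 0 := fun h => hj' (by rw [h, mul_zero])
    exact step_active_unique hq (step_active_of_ne_zero hq 1 j hz) (step_active_of_ne_zero hq 1 j' hz')

/-- On the open core `4ⁿ q < 2` (and `q > -1`, say) `H_n` is locally constant `= n`, so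
`H_n' = H_n'' = 0` there; likewise for `q > 1` where `H_n = 0`. [folklore] -/
theorem deriv_coreH_eq_zero (n : ℕ) {q : ℝ} (hq : (0 ≤ q ∧ 4 ^ n * q < 2) ∨ 1 < q) :
    deriv (coreH n) q = 0 ∧ deriv (deriv (coreH n)) q = 0 := by
  -- `H_n` is constant on an open neighbourhood of `q`
  have key : ∀ {U : Set ℝ} (_ : IsOpen U) {c : ℝ} (_ : ∀ s ∈ U, coreH n s = c) (_ : q ∈ U),
      deriv (coreH n) q = 0 ∧ deriv (deriv (coreH n)) q = 0 := by
    intro U hU c hc hqU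
    have h1 : ∀ s ∈ U, deriv (coreH n) s = 0 := fun s hs => by
      have := iteratedDeriv_succ_eq_zero_of_eqOn hU hc 0 s hs
      rwa [zero_add, iteratedDeriv_one] at this
    refine ⟨h1 q hqU, ?_⟩
    have hev : deriv (coreH n) =ᶠ[𝓝 q] fun _ => (0 : ℝ) :=
      eventuallyEq_of_mem (hU.mem_nhds hqU) fun t ht => h1 t ht
    rw [hev.deriv_eq, deriv_const]
  rcases hq with ⟨hq0, hc⟩ | h1
  · -- neighbourhood `{s | -4⁻ⁿ < s ∧ 4ⁿ s < 2}`: there `H_n = n` for `s ≥ 0`, but for `s < 0` the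
    -- steps are also `1` (`|4^{j+1} s| ≤ 2`), so use `U = {s | 4ⁿ |s| < 2}`.
    have hU : IsOpen {s : ℝ | (4 : ℝ) ^ n * |s| < 2} :=
      isOpen_lt (continuous_const.mul continuous_abs) continuous_const
    refine key hU (c := n) (fun s hs => ?_) (by simpa [abs_of_nonneg hq0] using hc)
    unfold coreH
    have h : ∀ j ∈ Finset.range n, stepB (4 ^ (j + 1) * s) = 1 := by
      intro j hj
      apply stepB_eq_one
      rw [abs_mul, abs_of_nonneg (by positivity)]
      have hj' : j + 1 ≤ n := Finset.mem_range.1 hj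
      have hs' : (4 : ℝ) ^ n * |s| < 2 := hs
      calc (4 : ℝ) ^ (j + 1) * |s| ≤ 4 ^ n * |s| :=
            mul_le_mul_of_nonneg_right (pow_le_pow_right₀ (by norm_num) hj') (abs_nonneg s)
        _ ≤ 2 := hs'.le
    rw [Finset.sum_congr rfl h]; simp
  · exact key (isOpen_lt continuous_const continuous_id) (c := 0)
      (fun s hs => coreH_eq_zero_of_one_le n (le_of_lt hs)) h1

end Sep3

end Summit.NavierStokesRegularity.FunctionalMining
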